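import Literature.Geometry.Lorentzian.LandauLifshitzPseudotensor

/-!
# Stub `stub_pseudotensorBound` (line `sublinear-is-free-clean-window-charges`), part 1:
# metric components within `1/2` of Minkowski — invertibility and uniform bounds

Helper file for `stmt-FinalStateConjecture-10166` (crux `InertialRecession`). The stub
`stub_pseudotensorBound` asks for a universal `C` with `|(−g)·t^{μν}_LL| ≤ C b²` whenever the metric
components `g x` lie within operator-norm distance `1/2` of `η` and `|∂g| ≤ b`. This file supplies
the zeroth-order (algebraic) half: for a bilinear form `B` on `E4 = ℝ⁴` with `‖B − η‖ ≤ 1/2`,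

* `coercive` — `B(v, ṽ) ≥ ‖v‖²/2` for the time-reflected vector `ṽ = v − 2v⁰ ∂₀` (since
  `η(v, ṽ) = ‖v‖²`, `‖ṽ‖ = ‖v‖`), hence `B` is nondegenerate and invertible
  (`nondegenerate`, `isInvertible`);
* `abs_gram_le`, `metricDet_ne_zero`, `abs_upper_le`, `abs_metricDet_le` — for `B = g x`:
  `|g_{μν}| ≤ 3/2`, `det (g_{μν}) ≠ 0`, `|g^{μν}| ≤ 2` (the rows of `(g_{μν})⁻¹` have Euclidean length
  `≤ 2` by coercivity), `|det (g_{μν})| ≤ 243/2` (Leibniz formula, `24 · (3/2)⁴`);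
* `abs_fderiv_basis_le`, `nonneg_of_fderiv_bound` — `|∂_α g_{ρσ}(x)| ≤ b` and `0 ≤ b` from
  `‖Dg(x) v‖ ≤ b ‖v‖`.

No definitions; Landau–Lifshitz §96 conventions of `LandauLifshitzPseudotensor.lean`.
-/

noncomputable section

set_option linter.dupNamespace false

open Filter Set
open scoped Topology Matrix RealInnerProductSpace

namespace Summit.FinalStateConjecture.FinalStateConjecture.Theorems.SublinearIsFree.PseudotensorBound

open Literature.Geometry.Lorentzian Literature.Geometry.Lorentzian.LandauLifshitz

/-! ### Coordinates on `E4` -/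

/-- `v = Σ_μ v^μ ∂_μ` on `E4`. [folklore] -/
private theorem eq_sum_smul_basisVector (v : E4) : v = ∑ μ, v μ • E4.basisVector μ := by
  have h := (EuclideanSpace.basisFun (Fin 4) ℝ).sum_repr' v
  conv_lhs => rw [← h]
  simp [EuclideanSpace.inner_single_left]

/-- `B(∂_μ, w) = Σ_ν w^ν B(∂_μ, ∂_ν)`. [folklore] -/
theorem bilin_basisVector_apply (B : E4 →L[ℝ] E4 →L[ℝ] ℝ) (μ : Fin 4) (w : E4) :
    B (E4.basisVector μ) w = ∑ ν, w ν * B (E4.basisVector μ) (E4.basisVector ν) := by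
  conv_lhs => rw [eq_sum_smul_basisVector w]
  simp only [map_sum, map_smul, smul_eq_mul]

/-- `B(v, ∂_ν) = Σ_μ v^μ B(∂_μ, ∂_ν) = (v ᵥ* (B_{μν}))_ν`. [folklore] -/
theorem bilin_apply_basisVector (B : E4 →L[ℝ] E4 →L[ℝ] ℝ) (v : E4) (ν : Fin 4) :
    B v (E4.basisVector ν) = ∑ μ, v μ * B (E4.basisVector μ) (E4.basisVector ν) := by
  conv_lhs => rw [eq_sum_smul_basisVector v]
  simp only [map_sum, map_smul, _root_.sum_apply, _root_.smul_apply,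
    smul_eq_mul]

/-! ### The time reflection `ṽ = v − 2 v⁰ ∂₀` -/

/-- Components of the time-reflected vector: `ṽ⁰ = −v⁰`, `ṽⁱ = vⁱ`. [folklore] -/
theorem reflect_apply (v : E4) (μ : Fin 4) :
    (v - (2 * v 0) • E4.basisVector 0) μ = if μ = 0 then -v 0 else v μ := by
  split_ifs with h
  · subst h; simp; ring
  · simp [h]

/-- `η(v, ṽ) = ‖v‖²`. [folklore] -/
theorem minkowski_apply_reflect (v : E4) :
    Minkowski.bilin v (v - (2 * v 0) • E4.basisVector 0) = ‖v‖ ^ 2 := by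
  rw [Minkowski.bilin_apply, EuclideanSpace.real_norm_sq_eq, Fin.sum_univ_four, Fin.sum_univ_three]
  simp only [reflect_apply, Fin.succ_zero_eq_one, Fin.succ_one_eq_two, if_true]
  simp only [show (1 : Fin 4) ≠ 0 from by decide, show (2 : Fin 4) ≠ 0 from by decide,
    show (Fin.succ (2 : Fin 3) : Fin 4) = 3 from rfl, show (3 : Fin 4) ≠ 0 from by decide, if_false]
  ring

/-- `‖ṽ‖ = ‖v‖`. [folklore] -/
theorem norm_reflect (v : E4) : ‖v - (2 * v 0) • E4.basisVector 0‖ = ‖v‖ := by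
  have h : ‖v - (2 * v 0) • E4.basisVector 0‖ ^ 2 = ‖v‖ ^ 2 := by
    rw [EuclideanSpace.real_norm_sq_eq, EuclideanSpace.real_norm_sq_eq, Fin.sum_univ_four,
      Fin.sum_univ_four]
    simp only [reflect_apply, if_true, show (1 : Fin 4) ≠ 0 from by decide,
      show (2 : Fin 4) ≠ 0 from by decide, show (3 : Fin 4) ≠ 0 from by decide, if_false]
    ring
  exact (pow_left_inj₀ (norm_nonneg _) (norm_nonneg _) two_ne_zero).mp h

/-! ### Coercivity, nondegeneracy, invertibility -/

variable {B : E4 →L[ℝ] E4 →L[ℝ] ℝ}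

/-- **Coercivity**: if `‖B − η‖ ≤ 1/2` then `B(v, ṽ) ≥ ‖v‖²/2`. [folklore] -/
theorem coercive (hB : ‖B - Minkowski.bilin‖ ≤ 1 / 2) (v : E4) :
    ‖v‖ ^ 2 / 2 ≤ B v (v - (2 * v 0) • E4.basisVector 0) := by
  set w := v - (2 * v 0) • E4.basisVector 0 with hw
  have hsplit : B v w = Minkowski.bilin v w + (B - Minkowski.bilin) v w := by
    simp only [_root_.sub_apply]; ring
  have hpert : |(B - Minkowski.bilin) v w| ≤ ‖v‖ ^ 2 / 2 := by
    calc |(B - Minkowski.bilin) v w| = ‖(B - Minkowski.bilin) v w‖ := (Real.norm_eq_abs _).symm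
      _ ≤ ‖B - Minkowski.bilin‖ * ‖v‖ * ‖w‖ := (B - Minkowski.bilin).le_opNorm₂ v w
      _ ≤ 1 / 2 * ‖v‖ * ‖v‖ := by rw [hw, norm_reflect]; gcongr
      _ = ‖v‖ ^ 2 / 2 := by ring
  rw [hsplit, minkowski_apply_reflect]
  have := neg_abs_le ((B - Minkowski.bilin) v w)
  linarith

/-- **Nondegeneracy**: if `‖B − η‖ ≤ 1/2` and `B(v, ·) = 0` then `v = 0`. [folklore] -/
theorem nondegenerate (hB : ‖B - Minkowski.bilin‖ ≤ 1 / 2) (v : E4) (hv : ∀ w, B v w = 0) :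
    v = 0 := by
  have h := coercive hB v
  rw [hv] at h
  have h0 : ‖v‖ ^ 2 ≤ 0 := by linarith
  have : ‖v‖ = 0 := by nlinarith [norm_nonneg v]
  exact norm_eq_zero.mp this

/-- **Invertibility**: if `‖B − η‖ ≤ 1/2` then `B : E4 → E4*` is invertible. [folklore] -/
theorem isInvertible (hB : ‖B - Minkowski.bilin‖ ≤ 1 / 2) : B.IsInvertible :=
  MetricCoord.isInvertible_of_nondegenerate (nondegenerate hB)

/-! ### Entries: `|B_{μν} − η_{μν}| ≤ 1/2` -/

/-- `|B(∂_μ, ∂_ν) − η(∂_μ, ∂_ν)| ≤ 1/2`. [folklore] -/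
theorem abs_apply_sub_minkowski_le (hB : ‖B - Minkowski.bilin‖ ≤ 1 / 2) (μ ν : Fin 4) :
    |B (E4.basisVector μ) (E4.basisVector ν)
      - Minkowski.bilin (E4.basisVector μ) (E4.basisVector ν)| ≤ 1 / 2 := by
  have h := (B - Minkowski.bilin).le_opNorm₂ (E4.basisVector μ) (E4.basisVector ν)
  simp only [_root_.sub_apply, PiLp.norm_single, norm_one, mul_one,
    Real.norm_eq_abs] at h
  exact h.trans hB

/-- `|η(∂_μ, ∂_ν)| ≤ 1`. [folklore] -/
theorem abs_minkowski_basis_le (μ ν : Fin 4) :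
    |Minkowski.bilin (E4.basisVector μ) (E4.basisVector ν)| ≤ 1 := by
  have h := congr_fun (congr_fun (gram_minkowski (0 : E4)) μ) ν
  rw [gram_apply] at h
  rw [h, Matrix.diagonal_apply]
  split_ifs <;> simp

/-- `|B(∂_μ, ∂_ν)| ≤ 3/2`. [folklore] -/
theorem abs_apply_basis_le (hB : ‖B - Minkowski.bilin‖ ≤ 1 / 2) (μ ν : Fin 4) :
    |B (E4.basisVector μ) (E4.basisVector ν)| ≤ 3 / 2 := by
  have h1 := abs_apply_sub_minkowski_le hB μ ν
  have h2 := abs_minkowski_basis_le μ ν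
  have := abs_sub_abs_le_abs_sub (B (E4.basisVector μ) (E4.basisVector ν))
    (Minkowski.bilin (E4.basisVector μ) (E4.basisVector ν))
  linarith

/-! ### The matrix of components: determinant and inverse -/

variable {g : E4 → E4 →L[ℝ] E4 →L[ℝ] ℝ} {x : E4}

/-- `|g_{μν}(x)| ≤ 3/2`. [folklore] -/
theorem abs_gram_le (hg : ‖g x - Minkowski.bilin‖ ≤ 1 / 2) (μ ν : Fin 4) :
    |gram g x μ ν| ≤ 3 / 2 :=
  abs_apply_basis_le hg μ ν

/-- `g_x(v, ∂_ν) = (v ᵥ* (g_{μν}))_ν`. [folklore] -/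
theorem apply_basisVector_eq_vecMul (v : E4) (ν : Fin 4) :
    g x v (E4.basisVector ν) = ((fun μ ↦ v μ) ᵥ* gram g x) ν := by
  rw [bilin_apply_basisVector, Matrix.vecMul, dotProduct]
  rfl

/-- **Row coercivity of the component matrix**: `‖c‖ ≤ 2 ‖c ᵥ* (g_{μν})‖` (Euclidean norms), from
`‖v‖²/2 ≤ g(v, ṽ) = ⟪c ᵥ* (g_{μν}), ṽ⟫ ≤ ‖c ᵥ* (g_{μν})‖ ‖v‖`. [folklore] -/
theorem norm_le_two_mul_norm_vecMul (hg : ‖g x - Minkowski.bilin‖ ≤ 1 / 2) (c : Fin 4 → ℝ) :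
    ‖(WithLp.toLp 2 c : E4)‖ ≤ 2 * ‖(WithLp.toLp 2 (c ᵥ* gram g x) : E4)‖ := by
  set v : E4 := WithLp.toLp 2 c with hv
  set w : E4 := v - (2 * v 0) • E4.basisVector 0 with hw
  set z : E4 := WithLp.toLp 2 (c ᵥ* gram g x) with hz
  have hco := coercive hg v
  -- `g(v, w) = ⟪z, w⟫`
  have hpair : g x v w = ⟪z, w⟫ := by
    have h1 : g x v w = ∑ ν, w ν * g x v (E4.basisVector ν) := by
      conv_lhs => rw [eq_sum_smul_basisVector w]
      simp only [map_sum, map_smul, smul_eq_mul]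
    rw [h1]
    simp only [apply_basisVector_eq_vecMul, PiLp.inner_apply, hz, RCLike.inner_apply, conj_trivial]
    rfl
  have hcs : g x v w ≤ ‖z‖ * ‖v‖ := by
    rw [hpair, ← norm_reflect v, ← hw]
    exact (le_abs_self _).trans (abs_real_inner_le_norm z w)
  have h : ‖v‖ ^ 2 / 2 ≤ ‖z‖ * ‖v‖ := hco.trans hcs
  by_cases hv0 : ‖v‖ = 0
  · rw [hv0]; positivity
  · have hpos : 0 < ‖v‖ := (norm_nonneg v).lt_of_ne (Ne.symm hv0)
    nlinarith

/-- **`det (g_{μν}(x)) ≠ 0`** when `‖g x − η‖ ≤ 1/2`. [folklore] -/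
theorem metricDet_ne_zero (hg : ‖g x - Minkowski.bilin‖ ≤ 1 / 2) : metricDet g x ≠ 0 := by
  intro hdet
  obtain ⟨c, hc, hcA⟩ := Matrix.exists_vecMul_eq_zero_iff.mpr hdet
  have h := norm_le_two_mul_norm_vecMul hg c
  rw [show gram g x = (gram g x) from rfl, hcA] at h
  have h0 : ‖(WithLp.toLp 2 c : E4)‖ ≤ 0 := by simpa using h
  have : (WithLp.toLp 2 c : E4) = 0 := norm_eq_zero.mp (le_antisymm h0 (norm_nonneg _))
  exact hc ((WithLp.toLp_eq_zero 2).mp this)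

/-- **`|g^{μν}(x)| ≤ 2`** when `‖g x − η‖ ≤ 1/2`: row `μ` of `(g_{μν})⁻¹` is `e_μ ᵥ* (g_{μν})⁻¹`, whose
image under `ᵥ* (g_{μν})` is `e_μ`, of length `1`. [folklore] -/
theorem abs_upper_le (hg : ‖g x - Minkowski.bilin‖ ≤ 1 / 2) (μ ν : Fin 4) :
    |upper g x μ ν| ≤ 2 := by
  have hdet : IsUnit (gram g x).det := isUnit_iff_ne_zero.mpr (metricDet_ne_zero hg)
  set c : Fin 4 → ℝ := (Pi.single μ 1 : Fin 4 → ℝ) ᵥ* (gram g x)⁻¹ with hc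
  have hcA : c ᵥ* gram g x = Pi.single μ 1 := by
    rw [hc, Matrix.vecMul_vecMul, Matrix.nonsing_inv_mul _ hdet, Matrix.vecMul_one]
  have hcν : c ν = upper g x μ ν := by
    rw [hc, upper]
    simp [Matrix.vecMul, dotProduct, Pi.single_apply]
  have h := norm_le_two_mul_norm_vecMul hg c
  rw [hcA] at h
  have h1 : ‖(WithLp.toLp 2 (Pi.single μ 1 : Fin 4 → ℝ) : E4)‖ = 1 := by
    rw [show (WithLp.toLp 2 (Pi.single μ 1 : Fin 4 → ℝ) : E4) = EuclideanSpace.single μ 1 from rfl]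
    simp
  rw [h1, mul_one] at h
  have h2 : |c ν| ≤ ‖(WithLp.toLp 2 c : E4)‖ := by
    have h3 : |c ν| ^ 2 ≤ ‖(WithLp.toLp 2 c : E4)‖ ^ 2 := by
      rw [EuclideanSpace.real_norm_sq_eq, sq_abs]
      exact Finset.single_le_sum (f := fun i ↦ ((WithLp.toLp 2 c : E4) i) ^ 2)
        (fun i _ ↦ sq_nonneg _) (Finset.mem_univ ν)
    nlinarith [abs_nonneg (c ν), norm_nonneg (WithLp.toLp 2 c : E4)]
  rw [← hcν]
  exact h2.trans h

/-- **`|det (g_{μν}(x))| ≤ 243/2`** when `‖g x − η‖ ≤ 1/2` (Leibniz: `24` products of four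
entries of size `≤ 3/2`). [folklore] -/
theorem abs_metricDet_le (hg : ‖g x - Minkowski.bilin‖ ≤ 1 / 2) : |metricDet g x| ≤ 243 / 2 := by
  rw [metricDet, Matrix.det_apply']
  have hterm : ∀ σ : Equiv.Perm (Fin 4),
      |(((Equiv.Perm.sign σ : ℤˣ) : ℤ) : ℝ) * ∏ i, gram g x (σ i) i| ≤ (3 / 2) ^ 4 := by
    intro σ
    rw [abs_mul]
    have hs : |(((Equiv.Perm.sign σ : ℤˣ) : ℤ) : ℝ)| = 1 := by
      rcases Int.units_eq_one_or (Equiv.Perm.sign σ) with h | h <;> simp [h]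
    rw [hs, one_mul, Finset.abs_prod]
    calc ∏ i, |gram g x (σ i) i| ≤ ∏ _i : Fin 4, (3 / 2 : ℝ) :=
          Finset.prod_le_prod (fun i _ ↦ abs_nonneg _) fun i _ ↦ abs_gram_le hg _ _
      _ = (3 / 2) ^ 4 := by rw [Finset.prod_const, Finset.card_univ, Fintype.card_fin]
  calc |∑ σ : Equiv.Perm (Fin 4), (((Equiv.Perm.sign σ : ℤˣ) : ℤ) : ℝ) * ∏ i, gram g x (σ i) i|
      ≤ ∑ σ : Equiv.Perm (Fin 4), |(((Equiv.Perm.sign σ : ℤˣ) : ℤ) : ℝ) * ∏ i, gram g x (σ i) i| :=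
        Finset.abs_sum_le_sum_abs _ _
    _ ≤ ∑ _σ : Equiv.Perm (Fin 4), ((3 / 2 : ℝ)) ^ 4 := Finset.sum_le_sum fun σ _ ↦ hterm σ
    _ = 243 / 2 := by
        rw [Finset.sum_const, Finset.card_univ, Fintype.card_perm, Fintype.card_fin]
        norm_num [Nat.factorial]

/-! ### First derivatives -/

/-- `0 ≤ b` whenever `‖Dg(x) v‖ ≤ b ‖v‖` for all `v`. [folklore] -/
theorem nonneg_of_fderiv_bound {b : ℝ} (hb : ∀ v : E4, ‖fderiv ℝ g x v‖ ≤ b * ‖v‖) : 0 ≤ b := by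
  have h := hb (E4.basisVector 0)
  simp only [PiLp.norm_single, norm_one, mul_one] at h
  exact le_trans (norm_nonneg ((fderiv ℝ g x) (E4.basisVector 0))) h

/-- `|∂_α g_{ρσ}(x)| ≤ b` from `‖Dg(x) v‖ ≤ b ‖v‖`. [folklore] -/
theorem abs_fderiv_basis_le {b : ℝ} (hb : ∀ v : E4, ‖fderiv ℝ g x v‖ ≤ b * ‖v‖) (α ρ σ : Fin 4) :
    |fderiv ℝ g x (E4.basisVector α) (E4.basisVector ρ) (E4.basisVector σ)| ≤ b := by
  have h1 : ‖fderiv ℝ g x (E4.basisVector α)‖ ≤ b := by simpa using hb (E4.basisVector α)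
  have h2 := (fderiv ℝ g x (E4.basisVector α)).le_opNorm₂ (E4.basisVector ρ) (E4.basisVector σ)
  simp only [PiLp.norm_single, norm_one, mul_one, Real.norm_eq_abs] at h2
  exact h2.trans h1

/-! ### Algebra of the Einstein tensor and of the pseudotensor density at a point -/

/-- `(g^{μν}) (g_{μν}) = 1` where `det (g_{μν}) ≠ 0`. [folklore] -/
theorem upper_mul_gram (hdet : metricDet g x ≠ 0) : upper g x * gram g x = 1 :=
  Matrix.nonsing_inv_mul _ (isUnit_iff_ne_zero.mpr hdet)

/-- **`G^{μν} = g^{μa} g^{νb} R_{ab} − ½ g^{μν} R`** for symmetric components with `det ≠ 0`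
(the `g_{ab}` in `einsteinUpper` contracts against one inverse: `g^{νb} g_{ab} = δ^ν_a`).
[cite: LandauLifshitz1975, §96 (96.7)] -/
theorem einsteinUpper_eq (hs : ∀ v w : E4, g x v w = g x w v) (hdet : metricDet g x ≠ 0)
    (μ ν : Fin 4) :
    einsteinUpper g x μ ν =
      ∑ a, ∑ b, upper g x μ a * upper g x ν b * ricci g x a b - 2⁻¹ * upper g x μ ν * scalar g x := by
  have h1 : ∀ a, ∑ b, upper g x ν b * gram g x a b = if ν = a then 1 else 0 := by
    intro a
    have h := congr_fun (congr_fun (upper_mul_gram hdet) ν) a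
    rw [Matrix.mul_apply, Matrix.one_apply] at h
    rw [← h]
    refine Finset.sum_congr rfl fun b _ ↦ ?_
    rw [gram_apply, gram_apply, hs]
  unfold einsteinUpper
  have h2 : ∀ a, ∑ b, upper g x μ a * upper g x ν b *
      (ricci g x a b - 2⁻¹ * scalar g x * gram g x a b) =
      ∑ b, upper g x μ a * upper g x ν b * ricci g x a b
        - 2⁻¹ * scalar g x * upper g x μ a * (if ν = a then 1 else 0) := by
    intro a
    rw [← h1 a, Finset.mul_sum, ← Finset.sum_sub_distrib]
    refine Finset.sum_congr rfl fun b _ ↦ ?_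
    ring
  simp only [h2, Finset.sum_sub_distrib, mul_ite, mul_one, mul_zero, Finset.sum_ite_eq,
    Finset.mem_univ, if_true]
  ring

/-- **`(det g) · t^{μν}_LL = −(Σ_α ∂_α h^{μνα}) − (8π)⁻¹ (det g) G^{μν}`** where `det (g_{μν}) ≠ 0`
(the definition (96.7) of the pseudotensor, cleared of its denominator).
[cite: LandauLifshitz1975, §96 (96.7)] -/
theorem metricDet_mul_pseudotensor (hdet : metricDet g x ≠ 0) (μ ν : Fin 4) :
    metricDet g x * pseudotensor g x μ ν =
      -emComplex g x μ ν - (8 * Real.pi)⁻¹ * metricDet g x * einsteinUpper g x μ ν := by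
  unfold pseudotensor
  have h : -metricDet g x ≠ 0 := neg_ne_zero.mpr hdet
  field_simp

/-! ### Registered sub-goal form -/

/-- Registered sub-goal form (part 1): `det ≠ 0`, `|det| ≤ 243/2`, `|g^{μν}| ≤ 2` when `‖g x − η‖ ≤ 1/2`. [folklore] -/
theorem pseudotensorBound_pointBounds : open Literature.Geometry.Lorentzian in ∀ {g : E4 → E4 →L[ℝ] E4 →L[ℝ] ℝ} {x : E4}, ‖g x - Minkowski.bilin‖ ≤ 1 / 2 → LandauLifshitz.metricDet g x ≠ 0 ∧ |LandauLifshitz.metricDet g x| ≤ 243 / 2 ∧ ∀ μ ν : Fin 4, |LandauLifshitz.upper g x μ ν| ≤ 2 :=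
  fun hg ↦ ⟨metricDet_ne_zero hg, abs_metricDet_le hg, abs_upper_le hg⟩

end Summit.FinalStateConjecture.FinalStateConjecture.Theorems.SublinearIsFree.PseudotensorBound

end
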